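import Literature.NumberTheory.Automorphic.ChevalleyIsomorphismOfAbstract
import Literature.NumberTheory.Automorphic.ReductiveDualAbstractIsomorphism
import HarnessLib

/-!
# The isomorphism theorem (Springer 9.6.2) in characteristic `0`: discharge of `chevalley_isomorphism`
(trunk T-AUTOMORPHIC, G25 AutomorphicL)

The named fact `Literature.NumberTheory.Automorphic.chevalley_isomorphism` (`ReductiveDual.lean`):
*two connected reductive groups over an algebraically closed field of characteristic `0` whose root
data (relative to maximal tori) are isomorphic are isomorphic as algebraic groups, by an isomorphism
mapping `T` onto `T'` and inducing the given isomorphism of root data* (Springer, *Linear Algebraic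
Groups*, 2nd ed., Theorem 9.6.2, with the standing characteristic-`0` hypothesis of the statement).

Springer's proof has two steps: (1) an isomorphism of *abstract* groups inducing the identity of the
root datum — the named fact `chevalley_isomorphism_abstract` (`ReductiveDualProofs.lean`), now a
theorem, `chevalley_isomorphism_abstract_holds` (`ReductiveDualAbstractIsomorphism.lean`, the graph
method of Chevalley / Humphreys §33 / Steinberg §10 carried out on the Lie algebra; an independent
route through the Lie-algebra isomorphism theorem is `LieGraphSetup … GraphGroupTorus.lean`);
(2) algebraicity of such an isomorphism — `chevalley_isomorphism_of_abstract`
(`ChevalleyIsomorphismOfAbstract.lean`: `𝔤^T = Lie(T)` in characteristic `0`, uniqueness of root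
subgroups, the open big cell and the rational big-cell formula, Springer 8.1–8.3 and step 2 of the
proof of 9.6.2). This file records the conclusion:

* **`chevalley_isomorphism_holds : chevalley_isomorphism`**.

No definition, no named fact; nothing is assumed. [cite: SpringerLAG1998, Theorem 9.6.2]

## References

* [SpringerLAG1998] T. A. Springer, *Linear Algebraic Groups*, 2nd ed., Progress in Mathematics 9,
  Birkhäuser (1998), Theorem 9.6.2 and its proof (9.6.1–9.6.2, 8.1.1–8.3.11).
-/

noncomputable section

open scoped MatrixGroups

namespace Literature.NumberTheory.Automorphic

variable {k : Type*} [Field k]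
variable {ι X Y : Type*} [AddCommGroup X] [AddCommGroup Y]
variable {N N' : ℕ} {G T : Subgroup (GL (Fin N) k)} {G' T' : Subgroup (GL (Fin N') k)}
  [IsMulCommutative ↥T] [IsMulCommutative ↥T']

/-- **The isomorphism theorem, Springer 9.6.2 (characteristic `0`), discharged: the named fact
`chevalley_isomorphism` holds** — from step 1 (`chevalley_isomorphism_abstract_holds`, the abstract
isomorphism inducing the identity of the root datum) and step 2 (`chevalley_isomorphism_of_abstract`,
its algebraicity). [cite: SpringerLAG1998, Theorem 9.6.2] -/
theorem chevalley_isomorphism_holds :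
    chevalley_isomorphism (k := k) (ι := ι) (X := X) (Y := Y) (G := G) (T := T) (G' := G') (T' := T') :=
  chevalley_isomorphism_of_abstract chevalley_isomorphism_abstract_holds

end Literature.NumberTheory.Automorphic
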